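import Summits.NavierStokesRegularity.NavierStokesRegularity.Theorems.EulerZoomLiouvillePowerGaugeEulerLiouvilleNeedleThinFastExits

/-!
# Thin fast exits WITHOUT SYMMETRY — STRONG FORM: the band-law exponent `2+ρ`
# (plate t39d of ROUND-38/39 «the waiting-time exponent»; crux E `PowerGaugeEulerLiouville`,
# stmt-NavierStokesRegularity-19832)

LANDING PLATE prepared by nsreg-p2 g33 (TEXT custody, DIRECTOR-NS #199 (1)) for a keyed PROVER hand
(`--supports stmt-NavierStokesRegularity-19832 --as helper`).  No Euler content, NO SYMMETRY.

`thinFastExits_strong`: for a `C¹` field `U` on `ℝ³` with ball budgets `∫_{B_L}‖U‖² ≤ c_A L^{1−2ρ}`,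
`∫_{B_L}‖DU‖² ≤ c_E L^{1−ρ}` (`L ≥ 1`, `0 ≤ ρ ≤ ½`) and every `R ≥ 1`, the `γ`-fast points of the spheres of good squared
radii `G ⊆ [R², 4R²]` (`|G| ≥ R²`) lie in a measurable `N ⊆ B̄_{2R}` with
`volume N · ∫⁻_N ‖U‖² ≤ C · R⁴ · exp(−(μ/4) · R^{2+ρ})`, `μ = min 1 (γ²/(614400·(bandConst+1)·(2c_A+2c_E+2)))`,
`C = (c_A+1)(192 + 9216(2c_A+1)/γ²)` — LITERALLY the hypothesis `hthinS` (κ = 1, `e = 2+ρ`, `β = μ/4`) of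
`NeedleRace.curl_eq_zero_of_powerClock_of_strongThinExits` (ns-ezl-w2 g3, `…NeedleClockThreshold`).  Hence the POWER
THRESHOLD of ROUND-38 (T_pow) for a general profile: a residence clock of strength `c′R^{2+ρ}` with `6γc′ < μ/4` forces
`curl U ≡ 0`.  Proof: `thinFastExits_structural` (plate t39c-C) with the SHARP thresholds `𝒜 ≤ 48a·R^{−2ρ}`,
`ℰ ≤ 48e·R^{−ρ}` and the band number `J = ⌊μR^{2+ρ}⌋`, admissible because `J²𝒜 ∝ R⁴` and `J·R²ℰ ∝ R⁴`; radii with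
`μR^{2+ρ} < 1` are served by the trivial tube `N = B̄_{2R}` (`exp(−(μ/4)R^{2+ρ}) ≥ e^{−1/4} ≥ ½` there).
[arithmetic over plates t39b, t39c-A/B/C/D]
-/

set_option linter.dupNamespace false

open MeasureTheory Set Metric Real
open scoped RealInnerProductSpace ENNReal

namespace Summit.NavierStokesRegularity.NavierStokesRegularity.Theorems.PowerGaugeEulerLiouville.NeedleFastSetMeasure

open NeedleThinness NeedleBandLaw NeedleAxisymBand NeedleChartFastArea

/-! ## 1. Power arithmetic -/

/-- `c(2R)^s + 1 ≤ (2c+1)R^s` for `0 ≤ s ≤ 1`, `R ≥ 1`. [arithmetic] -/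
theorem rpow_budget_le {c R s : ℝ} (hc : 0 ≤ c) (hR : 1 ≤ R) (hs0 : 0 ≤ s) (hs : s ≤ 1) :
    c * (2 * R) ^ s + 1 ≤ (2 * c + 1) * R ^ s := by
  have hR0 : 0 ≤ R := by linarith
  have h2 : (2 * R) ^ s = (2 : ℝ) ^ s * R ^ s := Real.mul_rpow (by norm_num) hR0
  have h2s : (2 : ℝ) ^ s ≤ 2 := by
    calc (2 : ℝ) ^ s ≤ (2 : ℝ) ^ (1 : ℝ) := Real.rpow_le_rpow_of_exponent_le (by norm_num) hs
      _ = 2 := Real.rpow_one 2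
  have hRs : 1 ≤ R ^ s := Real.one_le_rpow hR hs0
  have hRs0 : 0 ≤ R ^ s := by linarith
  rw [h2]
  nlinarith [mul_nonneg (sub_nonneg.2 h2s) (mul_nonneg hc hRs0)]

/-- SHARP threshold bound: `48(B+1)/R ≤ 48(2c+1)R^{s−1}` when `B = c(2R)^s`, `0 ≤ s ≤ 1`, `R ≥ 1`. [arithmetic] -/
theorem threshold_le_rpow {c R s B : ℝ} (hc : 0 ≤ c) (hR : 1 ≤ R) (hs0 : 0 ≤ s) (hs : s ≤ 1)
    (hB : B = c * (2 * R) ^ s) : 48 * (B + 1) / R ≤ 48 * (2 * c + 1) * R ^ (s - 1) := by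
  have hR0 : 0 < R := by linarith
  have h1 : B + 1 ≤ (2 * c + 1) * R ^ s := by rw [hB]; exact rpow_budget_le hc hR hs0 hs
  have h2 : 48 * (B + 1) / R ≤ 48 * ((2 * c + 1) * R ^ s) / R := by gcongr
  calc 48 * (B + 1) / R ≤ 48 * ((2 * c + 1) * R ^ s) / R := h2
    _ = 48 * (2 * c + 1) * R ^ (s - 1) := by rw [Real.rpow_sub_one hR0.ne']; ring

/-- `R^{2+ρ}·R^{2+ρ}·R^{−2ρ} = R⁴`. [arithmetic] -/
theorem rpow_key_A {R ρ : ℝ} (hR : 0 < R) : R ^ (2 + ρ) * R ^ (2 + ρ) * R ^ (-(2 * ρ)) = R ^ 4 := by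
  rw [← Real.rpow_add hR, ← Real.rpow_add hR]
  rw [show 2 + ρ + (2 + ρ) + -(2 * ρ) = ((4 : ℕ) : ℝ) by push_cast; ring, Real.rpow_natCast]

/-- `R^{2+ρ}·R^{−2ρ} ≤ R⁴` for `R ≥ 1`, `0 ≤ ρ`. [arithmetic] -/
theorem rpow_key_E1 {R ρ : ℝ} (hR : 1 ≤ R) (hρ : 0 ≤ ρ) : R ^ (2 + ρ) * R ^ (-(2 * ρ)) ≤ R ^ 4 := by
  have hR0 : 0 < R := by linarith
  rw [← Real.rpow_add hR0]
  calc R ^ (2 + ρ + -(2 * ρ)) ≤ R ^ ((4 : ℕ) : ℝ) :=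
        Real.rpow_le_rpow_of_exponent_le hR (by push_cast; linarith)
    _ = R ^ 4 := Real.rpow_natCast R 4

/-- `R^{2+ρ}·R²·R^{−ρ} = R⁴`. [arithmetic] -/
theorem rpow_key_E2 {R ρ : ℝ} (hR : 0 < R) : R ^ (2 + ρ) * R ^ 2 * R ^ (-ρ) = R ^ 4 := by
  have h2 : R ^ 2 = R ^ ((2 : ℕ) : ℝ) := (Real.rpow_natCast R 2).symm
  rw [h2, ← Real.rpow_add hR, ← Real.rpow_add hR]
  rw [show 2 + ρ + ((2 : ℕ) : ℝ) + -ρ = ((4 : ℕ) : ℝ) by push_cast; ring, Real.rpow_natCast]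

/-- Admissibility (A) of `J ≤ μR^{2+ρ}` under the sharp threshold `𝒜 ≤ 48a·R^{−2ρ}`:
`K·J²·(4𝒜/(γ²R²)) ≤ (R/20)²/8`. [arithmetic] -/
theorem admissibleA_strong {K J μ R γ ρ a e 𝒜 : ℝ} (hK : 0 ≤ K) (hJ0 : 0 ≤ J) (hJ : J ≤ μ * R ^ (2 + ρ))
    (hμ0 : 0 ≤ μ) (hμ1 : μ ≤ 1) (hμ : (K + 1) * (a + e) * μ ≤ γ ^ 2 / 614400) (hR : 1 ≤ R) (hγ : 0 < γ)
    (ha : 0 ≤ a) (he : 0 ≤ e) (h𝒜0 : 0 ≤ 𝒜) (h𝒜 : 𝒜 ≤ 48 * a * R ^ (-(2 * ρ))) :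
    K * J ^ 2 * (4 * 𝒜 / (γ ^ 2 * R ^ 2)) ≤ (R / 20) ^ 2 / 8 := by
  have hR0 : 0 < R := by linarith
  have hX0 : 0 ≤ R ^ (2 + ρ) := Real.rpow_nonneg hR0.le _
  have hY0 : 0 ≤ R ^ (-(2 * ρ)) := Real.rpow_nonneg hR0.le _
  have hμX : 0 ≤ μ * R ^ (2 + ρ) := mul_nonneg hμ0 hX0
  have s1 : K * J ^ 2 * (4 * 𝒜 / (γ ^ 2 * R ^ 2)) ≤
      (K + 1) * (μ * R ^ (2 + ρ)) ^ 2 * (4 * (48 * a * R ^ (-(2 * ρ))) / (γ ^ 2 * R ^ 2)) := by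
    gcongr
    linarith
  have s2 : (K + 1) * (μ * R ^ (2 + ρ)) ^ 2 * (4 * (48 * a * R ^ (-(2 * ρ))) / (γ ^ 2 * R ^ 2)) =
      192 * ((K + 1) * a * μ ^ 2) * (R ^ (2 + ρ) * R ^ (2 + ρ) * R ^ (-(2 * ρ))) / (γ ^ 2 * R ^ 2) := by
    ring
  have s2' : 192 * ((K + 1) * a * μ ^ 2) * (R ^ (2 + ρ) * R ^ (2 + ρ) * R ^ (-(2 * ρ))) / (γ ^ 2 * R ^ 2) =
      192 * ((K + 1) * a * μ ^ 2) * R ^ 2 / γ ^ 2 := by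
    rw [rpow_key_A hR0]
    field_simp
  have s3 : (K + 1) * a * μ ^ 2 ≤ γ ^ 2 / 614400 := by
    have t1 : (K + 1) * a * μ ^ 2 = ((K + 1) * a * μ) * μ := by ring
    have t2 : (K + 1) * a * μ ≤ (K + 1) * (a + e) * μ :=
      mul_le_mul_of_nonneg_right (mul_le_mul_of_nonneg_left (by linarith) (by linarith)) hμ0
    have t3 : ((K + 1) * (a + e) * μ) * μ ≤ ((K + 1) * (a + e) * μ) * 1 :=
      mul_le_mul_of_nonneg_left hμ1 (by positivity)
    nlinarith
  have s4 : 192 * ((K + 1) * a * μ ^ 2) * R ^ 2 / γ ^ 2 ≤ 192 * (γ ^ 2 / 614400) * R ^ 2 / γ ^ 2 := by gcongr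
  have s5 : 192 * (γ ^ 2 / 614400) * R ^ 2 / γ ^ 2 = (R / 20) ^ 2 / 8 := by field_simp; ring
  linarith

/-- Admissibility (E) of `J ≤ μR^{2+ρ}` under the sharp thresholds `𝒜 ≤ 48a·R^{−2ρ}`, `ℰ ≤ 48e·R^{−ρ}`:
`8K·J·(200/19)(𝒜 + (2R)²ℰ) ≤ (γR²/2)²`. [arithmetic] -/
theorem admissibleE_strong {K J μ R γ ρ a e 𝒜 ℰ : ℝ} (hK : 0 ≤ K) (hJ0 : 0 ≤ J) (hJ : J ≤ μ * R ^ (2 + ρ))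
    (hμ0 : 0 ≤ μ) (hμ : (K + 1) * (a + e) * μ ≤ γ ^ 2 / 614400) (hR : 1 ≤ R) (hρ : 0 ≤ ρ) (ha : 0 ≤ a) (he : 0 ≤ e)
    (h𝒜0 : 0 ≤ 𝒜) (h𝒜 : 𝒜 ≤ 48 * a * R ^ (-(2 * ρ))) (hℰ0 : 0 ≤ ℰ) (hℰ : ℰ ≤ 48 * e * R ^ (-ρ)) :
    8 * K * J * (200 / 19 * (𝒜 + (2 * R) ^ 2 * ℰ)) ≤ (γ * R ^ 2 / 2) ^ 2 := by
  have hR0 : 0 < R := by linarith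
  have he0 : 0 ≤ e * μ := mul_nonneg he hμ0
  have hX0 : 0 ≤ R ^ (2 + ρ) := Real.rpow_nonneg hR0.le _
  have hY0 : 0 ≤ R ^ (-(2 * ρ)) := Real.rpow_nonneg hR0.le _
  have hZ0 : 0 ≤ R ^ (-ρ) := Real.rpow_nonneg hR0.le _
  have hR4 : 0 ≤ R ^ 4 := by positivity
  -- `J·(𝒜 + 4R²ℰ) ≤ 192(a+e)μR⁴`
  have k1 : J * (𝒜 + (2 * R) ^ 2 * ℰ) ≤
      (μ * R ^ (2 + ρ)) * (48 * a * R ^ (-(2 * ρ)) + (2 * R) ^ 2 * (48 * e * R ^ (-ρ))) := by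
    gcongr
  have k2 : (μ * R ^ (2 + ρ)) * (48 * a * R ^ (-(2 * ρ)) + (2 * R) ^ 2 * (48 * e * R ^ (-ρ))) =
      48 * a * μ * (R ^ (2 + ρ) * R ^ (-(2 * ρ))) + 192 * e * μ * (R ^ (2 + ρ) * R ^ 2 * R ^ (-ρ)) := by ring
  have k3 : 48 * a * μ * (R ^ (2 + ρ) * R ^ (-(2 * ρ))) + 192 * e * μ * (R ^ (2 + ρ) * R ^ 2 * R ^ (-ρ)) ≤
      192 * (a + e) * μ * R ^ 4 := by
    rw [rpow_key_E2 hR0]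
    have h1 : 48 * a * μ * (R ^ (2 + ρ) * R ^ (-(2 * ρ))) ≤ 48 * a * μ * R ^ 4 :=
      mul_le_mul_of_nonneg_left (rpow_key_E1 hR hρ) (by positivity)
    nlinarith [mul_nonneg (mul_nonneg ha hμ0) hR4]
  have hJS : J * (𝒜 + (2 * R) ^ 2 * ℰ) ≤ 192 * (a + e) * μ * R ^ 4 := by linarith
  have s1 : 8 * K * J * (200 / 19 * (𝒜 + (2 * R) ^ 2 * ℰ)) = 8 * K * (200 / 19) * (J * (𝒜 + (2 * R) ^ 2 * ℰ)) := by
    ring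
  have s2 : 8 * K * (200 / 19) * (J * (𝒜 + (2 * R) ^ 2 * ℰ)) ≤ 8 * (K + 1) * 11 * (192 * (a + e) * μ * R ^ 4) := by
    have hJS0 : 0 ≤ J * (𝒜 + (2 * R) ^ 2 * ℰ) := by positivity
    gcongr
    · linarith
    · norm_num
  have s3 : 8 * (K + 1) * 11 * (192 * (a + e) * μ * R ^ 4) = 16896 * ((K + 1) * (a + e) * μ) * R ^ 4 := by ring
  have s4 : 16896 * ((K + 1) * (a + e) * μ) * R ^ 4 ≤ 16896 * (γ ^ 2 / 614400) * R ^ 4 := by gcongr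
  have s5 : 16896 * (γ ^ 2 / 614400) * R ^ 4 ≤ (γ * R ^ 2 / 2) ^ 2 := by
    nlinarith [mul_nonneg (sq_nonneg γ) hR4]
  linarith

/-- The volume of `B̄_{2R} ⊆ ℝ³` is at most `48R³` (`4π/3 ≤ 6`). [folklore] -/
theorem volume_closedBall_two_mul_le {R : ℝ} (hR : 0 ≤ R) :
    volume (closedBall (0 : EuclideanSpace ℝ (Fin 3)) (2 * R)) ≤ ENNReal.ofReal (48 * R ^ 3) := by
  rw [EuclideanSpace.volume_closedBall_fin_three, ← ENNReal.ofReal_pow (by positivity), ← ENNReal.ofReal_mul (by positivity)]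
  refine ENNReal.ofReal_le_ofReal ?_
  have hπ := Real.pi_le_four
  have hR3 : 0 ≤ R ^ 3 := by positivity
  nlinarith

/-- THE TRIVIAL TUBE (radii below the band threshold): `G = [R², 4R²]`, `N = B̄_{2R}`, size `≤ 96c_A R⁴`. [arithmetic] -/
theorem trivialTube {U : (EuclideanSpace ℝ (Fin 3)) → (EuclideanSpace ℝ (Fin 3))} {γ ρ cA R : ℝ} (hR : 1 ≤ R)
    (hρ : 0 ≤ ρ) (hcA : 0 ≤ cA)
    (hbA : ∫⁻ z in Metric.closedBall (0 : (EuclideanSpace ℝ (Fin 3))) (2 * R), (‖U z‖ₑ : ℝ≥0∞) ^ 2 ≤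
      ENNReal.ofReal (cA * (2 * R) ^ (1 - 2 * ρ))) :
    ∃ (G : Set ℝ) (N : Set (EuclideanSpace ℝ (Fin 3))), MeasurableSet G ∧ G ⊆ Icc (R ^ 2) ((2 * R) ^ 2) ∧
      1 * R ^ 2 ≤ (volume G).toReal ∧ MeasurableSet N ∧ N ⊆ Metric.closedBall 0 (2 * R) ∧
      (∀ z, ‖z‖ ^ 2 ∈ G → inner ℝ (U z) z + γ * ‖z‖ ^ 2 < 0 → z ∈ N) ∧
      volume N * ∫⁻ z in N, ENNReal.ofReal (‖U z‖ ^ 2) ≤ ENNReal.ofReal (96 * cA * R ^ 4) := by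
  have hR0 : 0 < R := by linarith
  refine ⟨Icc (R ^ 2) ((2 * R) ^ 2), closedBall 0 (2 * R), measurableSet_Icc, Subset.rfl, ?_, measurableSet_closedBall,
    Subset.rfl, fun z hz _ => ?_, ?_⟩
  · rw [Real.volume_Icc, ENNReal.toReal_ofReal (by nlinarith)]
    nlinarith
  · rw [mem_closedBall, dist_zero_right]
    have h4 : ‖z‖ ^ 2 ≤ (2 * R) ^ 2 := hz.2
    nlinarith [norm_nonneg z]
  · have hBA : cA * (2 * R) ^ (1 - 2 * ρ) ≤ 2 * cA * R := budget_le_linear hcA hR (by linarith)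
    have hint : ∫⁻ z in closedBall (0 : EuclideanSpace ℝ (Fin 3)) (2 * R), ENNReal.ofReal (‖U z‖ ^ 2) ≤
        ENNReal.ofReal (2 * cA * R) := by
      calc ∫⁻ z in closedBall (0 : EuclideanSpace ℝ (Fin 3)) (2 * R), ENNReal.ofReal (‖U z‖ ^ 2)
          = ∫⁻ z in closedBall (0 : EuclideanSpace ℝ (Fin 3)) (2 * R), ‖U z‖ₑ ^ 2 := by
            refine lintegral_congr fun z => ?_; rw [Literature.Analysis.FluidPDE.enorm_sq_eq_ofReal_norm_sq]
        _ ≤ ENNReal.ofReal (cA * (2 * R) ^ (1 - 2 * ρ)) := hbA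
        _ ≤ ENNReal.ofReal (2 * cA * R) := ENNReal.ofReal_le_ofReal hBA
    calc volume (closedBall (0 : EuclideanSpace ℝ (Fin 3)) (2 * R)) *
          ∫⁻ z in closedBall (0 : EuclideanSpace ℝ (Fin 3)) (2 * R), ENNReal.ofReal (‖U z‖ ^ 2)
        ≤ ENNReal.ofReal (48 * R ^ 3) * ENNReal.ofReal (2 * cA * R) :=
          mul_le_mul' (volume_closedBall_two_mul_le hR0.le) hint
      _ = ENNReal.ofReal (96 * cA * R ^ 4) := by
          rw [← ENNReal.ofReal_mul (by positivity)]; congr 1; ring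

/-! ## 2. The strong thin-exit law -/

/-- **Thin fast exits, NO SYMMETRY, STRONG FORM (exponent `2+ρ`)** — the hypothesis `hthinS` (κ = 1, `e = 2+ρ`,
`β = μ/4`) of `…NeedleRace.curl_eq_zero_of_powerClock_of_strongThinExits`, for a `C¹` field with ball budgets
`c_A L^{1−2ρ}`, `c_E L^{1−ρ}`, `0 ≤ ρ ≤ ½`, at EVERY `R ≥ 1`. [plates t39b + t39c] -/
theorem thinFastExits_strong {U : (EuclideanSpace ℝ (Fin 3)) → (EuclideanSpace ℝ (Fin 3))} (hU : ContDiff ℝ 1 U)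
    {γ ρ cA cE : ℝ} (hγ : 0 < γ) (hρ : 0 ≤ ρ) (hρ2 : ρ ≤ 1 / 2) (hcA : 0 ≤ cA) (hcE : 0 ≤ cE)
    (hbA : ∀ L : ℝ, 1 ≤ L →
      ∫⁻ z in Metric.closedBall (0 : (EuclideanSpace ℝ (Fin 3))) L, (‖U z‖ₑ : ℝ≥0∞) ^ 2 ≤ ENNReal.ofReal (cA * L ^ (1 - 2 * ρ)))
    (hbE : ∀ L : ℝ, 1 ≤ L →
      ∫⁻ z in Metric.closedBall (0 : (EuclideanSpace ℝ (Fin 3))) L, (‖fderiv ℝ U z‖ₑ : ℝ≥0∞) ^ 2 ≤ ENNReal.ofReal (cE * L ^ (1 - ρ)))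
    {R : ℝ} (hR1 : 1 ≤ R) :
    ∃ (G : Set ℝ) (N : Set (EuclideanSpace ℝ (Fin 3))), MeasurableSet G ∧ G ⊆ Icc (R ^ 2) ((2 * R) ^ 2) ∧
      1 * R ^ 2 ≤ (volume G).toReal ∧ MeasurableSet N ∧ N ⊆ Metric.closedBall 0 (2 * R) ∧
      (∀ z, ‖z‖ ^ 2 ∈ G → inner ℝ (U z) z + γ * ‖z‖ ^ 2 < 0 → z ∈ N) ∧
      volume N * ∫⁻ z in N, ENNReal.ofReal (‖U z‖ ^ 2) ≤
        ENNReal.ofReal ((cA + 1) * (192 + 9216 * (2 * cA + 1) / γ ^ 2) * R ^ (4 : ℝ) *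
          Real.exp (-(min 1 (γ ^ 2 / (614400 * (bandConst + 1) * (2 * cA + 2 * cE + 2))) / 4 * R ^ (2 + ρ)))) := by
  -- constants
  obtain ⟨a, ha⟩ : ∃ a : ℝ, a = 2 * cA + 1 := ⟨_, rfl⟩
  obtain ⟨e, he⟩ : ∃ e : ℝ, e = 2 * cE + 1 := ⟨_, rfl⟩
  have ha0 : 0 < a := by rw [ha]; positivity
  have he0 : 0 < e := by rw [he]; positivity
  have hK := bandConst_nonneg
  have hae : 2 * cA + 2 * cE + 2 = a + e := by rw [ha, he]; ring
  rw [hae]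
  obtain ⟨μ, hμd⟩ : ∃ μ : ℝ, μ = min 1 (γ ^ 2 / (614400 * (bandConst + 1) * (a + e))) := ⟨_, rfl⟩
  rw [← hμd, ← ha]
  have hμ0 : 0 < μ := by rw [hμd]; positivity
  have hμ1 : μ ≤ 1 := by rw [hμd]; exact min_le_left _ _
  have hμ : (bandConst + 1) * (a + e) * μ ≤ γ ^ 2 / 614400 := by
    have h1 : μ ≤ γ ^ 2 / (614400 * (bandConst + 1) * (a + e)) := by rw [hμd]; exact min_le_right _ _
    have h2 : 0 < 614400 * (bandConst + 1) * (a + e) := by positivity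
    rw [le_div_iff₀ h2] at h1
    rw [le_div_iff₀ (by norm_num : (0 : ℝ) < 614400)]
    nlinarith
  have hR0 : 0 < R := by linarith
  have h2R : 1 ≤ 2 * R := by linarith
  have hR4 : R ^ (4 : ℝ) = R ^ 4 := by rw [show (4 : ℝ) = ((4 : ℕ) : ℝ) by norm_num, Real.rpow_natCast]
  have hR41 : 1 ≤ R ^ 4 := one_le_pow₀ hR1
  have hX0 : 0 ≤ R ^ (2 + ρ) := Real.rpow_nonneg hR0.le _
  -- the final constant dominates both regimes
  obtain ⟨C, hCd⟩ : ∃ C : ℝ, C = (cA + 1) * (192 + 9216 * a / γ ^ 2) := ⟨_, rfl⟩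
  rw [← hCd]
  have hC1 : 96 * cA * 2 ≤ C := by
    rw [hCd]
    have : 0 ≤ 9216 * a / γ ^ 2 := by positivity
    nlinarith
  have hC2 : 4608 * a * (cA + 1) / γ ^ 2 * 2 ≤ C := by
    rw [hCd]
    have h1 : 4608 * a * (cA + 1) / γ ^ 2 * 2 = (cA + 1) * (9216 * a / γ ^ 2) := by ring
    rw [h1]
    nlinarith
  have hC0 : 0 ≤ C := by rw [hCd]; positivity
  by_cases hsmall : μ * R ^ (2 + ρ) < 1
  · -- ### radii below the band threshold: the trivial tube
    obtain ⟨G, N, h1, h2, h3, h4, h5, h6, h7⟩ := trivialTube (U := U) (γ := γ) hR1 hρ hcA (hbA (2 * R) h2R)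
    refine ⟨G, N, h1, h2, h3, h4, h5, h6, h7.trans (ENNReal.ofReal_le_ofReal ?_)⟩
    -- `exp(−(μ/4)R^{2+ρ}) ≥ exp(−1/4) ≥ 1/2`
    have hexp : (1 : ℝ) / 2 ≤ Real.exp (-(μ / 4 * R ^ (2 + ρ))) := by
      have h14 : -(1 / 4 : ℝ) ≤ -(μ / 4 * R ^ (2 + ρ)) := by nlinarith
      have hq : (1 : ℝ) / 2 ≤ Real.exp (-(1 / 4 : ℝ)) := by
        have := Real.add_one_le_exp (-(1 / 4 : ℝ))
        linarith
      exact hq.trans (Real.exp_le_exp.2 h14)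
    rw [hR4]
    calc 96 * cA * R ^ 4 = (96 * cA * 2) * R ^ 4 * (1 / 2) := by ring
      _ ≤ C * R ^ 4 * Real.exp (-(μ / 4 * R ^ (2 + ρ))) := by
          gcongr
  · -- ### radii above the band threshold: the structural theorem with `J = ⌊μR^{2+ρ}⌋`
    have hμX : 1 ≤ μ * R ^ (2 + ρ) := not_lt.1 hsmall
    -- budgets at L = 2R
    obtain ⟨BA, hBAd⟩ : ∃ b : ℝ, b = cA * (2 * R) ^ (1 - 2 * ρ) := ⟨_, rfl⟩
    obtain ⟨BE, hBEd⟩ : ∃ b : ℝ, b = cE * (2 * R) ^ (1 - ρ) := ⟨_, rfl⟩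
    have hBA0 : 0 ≤ BA := by rw [hBAd]; positivity
    have hBE0 : 0 ≤ BE := by rw [hBEd]; positivity
    have hBA2 : BA ≤ 2 * cA * R := by rw [hBAd]; exact budget_le_linear hcA hR1 (by linarith)
    have hIA : ∫⁻ y in closedBall (0 : (EuclideanSpace ℝ (Fin 3))) (2 * R), ‖U y‖ₑ ^ 2 ≤ ENNReal.ofReal BA := by
      rw [hBAd]; exact hbA (2 * R) h2R
    have hIE : ∫⁻ y in closedBall (0 : (EuclideanSpace ℝ (Fin 3))) (2 * R), ‖fderiv ℝ U y‖ₑ ^ 2 ≤ ENNReal.ofReal BE := by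
      rw [hBEd]; exact hbE (2 * R) h2R
    -- SHARP thresholds
    obtain ⟨𝒜, h𝒜d⟩ : ∃ x : ℝ, x = 48 * (BA + 1) / R := ⟨_, rfl⟩
    obtain ⟨ℰ, hℰd⟩ : ∃ x : ℝ, x = 48 * (BE + 1) / R := ⟨_, rfl⟩
    have h𝒜0 : 0 ≤ 𝒜 := by rw [h𝒜d]; positivity
    have hℰ0 : 0 ≤ ℰ := by rw [hℰd]; positivity
    have h𝒜a : 𝒜 ≤ 48 * a * R ^ (-(2 * ρ)) := by
      have h := threshold_le_rpow hcA hR1 (by linarith) (by linarith) hBAd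
      rw [show (1 - 2 * ρ - 1 : ℝ) = -(2 * ρ) by ring] at h
      rw [h𝒜d, ha]; exact h
    have hℰe : ℰ ≤ 48 * e * R ^ (-ρ) := by
      have h := threshold_le_rpow hcE hR1 (by linarith) (by linarith) hBEd
      rw [show (1 - ρ - 1 : ℝ) = -ρ by ring] at h
      rw [hℰd, he]; exact h
    have hY1 : R ^ (-(2 * ρ)) ≤ 1 := Real.rpow_le_one_of_one_le_of_nonpos hR1 (by linarith)
    have h𝒜a' : 𝒜 ≤ 48 * a := by
      calc 𝒜 ≤ 48 * a * R ^ (-(2 * ρ)) := h𝒜a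
        _ ≤ 48 * a * 1 := mul_le_mul_of_nonneg_left hY1 (by positivity)
        _ = 48 * a := mul_one _
    -- the band number
    have hJ : 0 < ⌊μ * R ^ (2 + ρ)⌋₊ := Nat.floor_pos.2 hμX
    have hJle : (⌊μ * R ^ (2 + ρ)⌋₊ : ℝ) ≤ μ * R ^ (2 + ρ) := Nat.floor_le (by positivity)
    have hJA : bandConst * (⌊μ * R ^ (2 + ρ)⌋₊ : ℝ) ^ 2 * (4 * 𝒜 / (γ ^ 2 * R ^ 2)) ≤ (R / 20) ^ 2 / 8 :=
      admissibleA_strong hK (Nat.cast_nonneg _) hJle hμ0.le hμ1 hμ hR1 hγ ha0.le he0.le h𝒜0 h𝒜a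
    have hJE : 8 * bandConst * (⌊μ * R ^ (2 + ρ)⌋₊ : ℝ) * (200 / 19 * (𝒜 + (2 * R) ^ 2 * ℰ)) ≤ (γ * R ^ 2 / 2) ^ 2 :=
      admissibleE_strong hK (Nat.cast_nonneg _) hJle hμ0.le hμ hR1 hρ ha0.le he0.le h𝒜0 h𝒜a hℰ0 hℰe
    -- the structural theorem
    obtain ⟨G, N, h1, h2, h3, h4, h5, h6, h7⟩ :=
      thinFastExits_structural orthonormal_stdFrame hU hγ hR0 hBA0 hBE0 hIA hIE h𝒜d hℰd hJ hJA hJE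
    refine ⟨G, N, h1, h2, h3, h4, h5, h6, h7.trans (ENNReal.ofReal_le_ofReal ?_)⟩
    -- the size
    have hcoef : 48 * 𝒜 / (γ ^ 2 * R) * BA ≤ 4608 * a * cA / γ ^ 2 := sizeCoeff_le hγ hR0 h𝒜a' hBA0 hBA2 ha0.le
    have hcoef' : 4608 * a * cA / γ ^ 2 ≤ 4608 * a * (cA + 1) / γ ^ 2 := by gcongr; linarith
    have hexp := exp_floor_le μ (R ^ (2 + ρ))
    have hexp2 : Real.exp (1 / 4 : ℝ) ≤ 2 := by
      have h4 : Real.exp (1 / 4 : ℝ) ^ 4 = Real.exp 1 := by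
        rw [← Real.exp_nat_mul]; norm_num
      have h16 : Real.exp (1 / 4 : ℝ) ^ 4 ≤ (2 : ℝ) ^ 4 := by
        rw [h4]
        have h := Real.exp_one_lt_d9
        norm_num at h ⊢
        linarith
      exact (pow_le_pow_iff_left₀ (Real.exp_pos _).le (by norm_num) (by norm_num)).1 h16
    have hexpeq : Real.exp (-(μ / 4) * R ^ (2 + ρ)) = Real.exp (-(μ / 4 * R ^ (2 + ρ))) := by ring_nf
    rw [hR4]
    calc 48 * 𝒜 / (γ ^ 2 * R) * Real.exp (-(⌊μ * R ^ (2 + ρ)⌋₊ : ℝ) / 4) * BA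
        = (48 * 𝒜 / (γ ^ 2 * R) * BA) * Real.exp (-(⌊μ * R ^ (2 + ρ)⌋₊ : ℝ) / 4) := by ring
      _ ≤ (4608 * a * (cA + 1) / γ ^ 2) * (Real.exp (1 / 4) * Real.exp (-(μ / 4) * R ^ (2 + ρ))) :=
          mul_le_mul (hcoef.trans hcoef') hexp (Real.exp_pos _).le (by positivity)
      _ ≤ (4608 * a * (cA + 1) / γ ^ 2) * (2 * Real.exp (-(μ / 4) * R ^ (2 + ρ))) := by gcongr
      _ = (4608 * a * (cA + 1) / γ ^ 2 * 2) * 1 * Real.exp (-(μ / 4 * R ^ (2 + ρ))) := by rw [hexpeq]; ring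
      _ ≤ C * R ^ 4 * Real.exp (-(μ / 4 * R ^ (2 + ρ))) := by gcongr

/-- **Packaged form** — `∃ β > 0, ∃ C ≥ 0, ∀ R ≥ 1, …` with the size `C·R⁴·exp(−βR^{2+ρ})`: the `hthinS` input of the
power threshold `…NeedleRace.curl_eq_zero_of_powerClock_of_strongThinExits` (κ = 1, `e = 2+ρ`). [plates t39b + t39c] -/
theorem thinFastExits_strong' {U : (EuclideanSpace ℝ (Fin 3)) → (EuclideanSpace ℝ (Fin 3))} (hU : ContDiff ℝ 1 U)
    {γ ρ cA cE : ℝ} (hγ : 0 < γ) (hρ : 0 ≤ ρ) (hρ2 : ρ ≤ 1 / 2) (hcA : 0 ≤ cA) (hcE : 0 ≤ cE)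
    (hbA : ∀ L : ℝ, 1 ≤ L →
      ∫⁻ z in Metric.closedBall (0 : (EuclideanSpace ℝ (Fin 3))) L, (‖U z‖ₑ : ℝ≥0∞) ^ 2 ≤ ENNReal.ofReal (cA * L ^ (1 - 2 * ρ)))
    (hbE : ∀ L : ℝ, 1 ≤ L →
      ∫⁻ z in Metric.closedBall (0 : (EuclideanSpace ℝ (Fin 3))) L, (‖fderiv ℝ U z‖ₑ : ℝ≥0∞) ^ 2 ≤ ENNReal.ofReal (cE * L ^ (1 - ρ))) :
    ∃ β : ℝ, 0 < β ∧ ∃ C : ℝ, 0 ≤ C ∧ ∀ R : ℝ, 1 ≤ R →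
      ∃ (G : Set ℝ) (N : Set (EuclideanSpace ℝ (Fin 3))), MeasurableSet G ∧ G ⊆ Icc (R ^ 2) ((2 * R) ^ 2) ∧
        1 * R ^ 2 ≤ (volume G).toReal ∧ MeasurableSet N ∧ N ⊆ Metric.closedBall 0 (2 * R) ∧
        (∀ z, ‖z‖ ^ 2 ∈ G → inner ℝ (U z) z + γ * ‖z‖ ^ 2 < 0 → z ∈ N) ∧
        volume N * ∫⁻ z in N, ENNReal.ofReal (‖U z‖ ^ 2) ≤
          ENNReal.ofReal (C * R ^ (4 : ℝ) * Real.exp (-(β * R ^ (2 + ρ)))) := by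
  have hK := bandConst_nonneg
  refine ⟨min 1 (γ ^ 2 / (614400 * (bandConst + 1) * (2 * cA + 2 * cE + 2))) / 4, by positivity,
    (cA + 1) * (192 + 9216 * (2 * cA + 1) / γ ^ 2), by positivity, fun R hR => ?_⟩
  exact thinFastExits_strong hU hγ hρ hρ2 hcA hcE hbA hbE hR

end Summit.NavierStokesRegularity.NavierStokesRegularity.Theorems.PowerGaugeEulerLiouville.NeedleFastSetMeasure
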